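import Summits.HodgeConjecture.HodgeConjecture.Theorems.F0P3cStCharTSCartanAll          -- ★ p851840 (F0P3a-p03) CARTAN-ALL: `exists_cartanAll_weylShape`
import Summits.HodgeConjecture.HodgeConjecture.Theorems.F0P3cStCharTSCartanFinTwo       -- ★ (F0P2-p01) CARTAN-ELL-H: `cartanEllH`
import Summits.HodgeConjecture.HodgeConjecture.Theorems.F0P3cStCharTSWeylCartanOrbInt   -- ★ (F0P3a-p05) (E3): `exists_haar_cartan_compactCore_eq_one`
import HarnessLib

/-!
# F0 · P3c · line LH6 «StCharTS» — «INSTANTIATE-CARTAN»: the CARTAN DATA of the rung-0 organ `stub_EllipticInputs` EXIST as stated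

Cell `pub/hodgecm-mathlib`, crux H413 = `stmt-HodgeConjecture-24833` (lane `--supports …`), route HCCMUnconditional; seat LH6-p01 (g5) (datum-road map owner ∕ junction–rung-0 pen).
THEOREMS ONLY; ★-only imports.

WHAT.  `exists_cartanInputs`: at a finite place `v` of `L⁺` non-split in the CM field `L` there are `Sell μTf SH μTHf` satisfying the TWELVE Cartan binders of ★ RUNG0 v4
(`F0P3cStCharTSRung0Four.ellipticPackage_hyps_of_namedBlock₄`, = the Cartan part of the leaf's future organ `stub_EllipticInputs`) TOKEN FOR TOKEN: `hcartO` (`Sell` = compact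
centralisers `Z(γ₀)` of regular elements) · `hcovGO` ∕ `hncGO` (`insert M Sell` meets every regular conjugacy class ∕ is irredundant — conjugacy in ★ CARTAN-ALL's letters) · `hHaarGO` ∕
`hcoreGO` ∕ `hHaarMO` ∕ `hcoreMO` (`μTf` Haar with mass one on the compact core, on each `T ∈ Sell` and on the split torus `M` — THE normalisation of the canonical orbital measures) ·
`hKHO` ∕ `hcovHO` ∕ `hncHO` ∕ `hHaarHO` ∕ `hprobHO` (`SH` compact `Z_H(γ₀)` with `γ₀` `G`-regular, complete, irredundant, `μTHf` Haar probability).  PROOF: ★ CARTAN-ALL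
`exists_cartanAll_weylShape` gives `C ∋ M`; `Sell := C.erase M` and `insert M (C.erase M) = C`; `μTf T := ` THE measure of ★ (E3) `exists_haar_cartan_compactCore_eq_one` for `T ∈ C`
(by choice; `0` off `C`, unread); the `H` side is ★ `cartanEllH` verbatim.  So the consuming leaf edition discharges the four Cartan objects and their twelve binders by ONE `obtain`;
what then remains of `stub_EllipticInputs` is the type-(3) torus `T` with `hT3`∕`hGerm`, §1.6, (HC-B), `hKeysRed`, `hLdsTwo`, `hDGliO` and the named block.
HONEST LABEL: HC_CM is proved only modulo the 7 printed citations (2 remaining named inputs: hLiu418 = `stmt-HodgeConjecture-24832`, h413 = `stmt-HodgeConjecture-24833`) until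
rung 0 closes; count-neutral — this pays in-house binders of an organ, closes no organ.

## References
* [Rogawski1990] J. D. Rogawski, *Automorphic Representations of Unitary Groups in Three Variables*, Ann. of Math. Stud. 123 (1990): §3.6 pp. 28–31; §4.3 (4.3.1) p. 43; §12.5 pp. 182–184.
* [PlatonovRapinchuk1994] V. Platonov, A. Rapinchuk, *Algebraic Groups and Number Theory* (1994), §6.4 Cor. 1 (finitely many conjugacy classes of tori).
-/

set_option autoImplicit false
-- the mandated namespace has the single-problem summit's repeated segment (`HodgeConjecture.HodgeConjecture`)
set_option linter.dupNamespace false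

noncomputable section

open NumberField IsDedekindDomain MeasureTheory Filter Topology
open scoped Matrix MatrixGroups NNReal
open Literature.NumberTheory.Rogawski1990 Literature.NumberTheory.Automorphic Literature.NumberTheory.Automorphic.UnitaryGroup
open Literature.NumberTheory.GaloisRepresentations

namespace Summit.HodgeConjecture.HodgeConjecture.Cruxes.H413.F0P3cStCharTSRung0Cartan

variable (L : Type) [Field L] [NumberField L] [IsCMField L] (v : HeightOneSpectrum (𝓞 ↥(maximalRealSubfield L)))

open scoped Classical in
-- `insert M Sell` is read with the classical `DecidableEq (Subgroup G)`, as in ★ RUNG0 v4's binders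
/-- **«INSTANTIATE-CARTAN»** — the Cartan data `Sell μTf SH μTHf` of the rung-0 organ exist with its twelve binders token for token (see the module docstring).
[cite: Rogawski1990, §3.6 pp. 28–31; §4.3 (4.3.1) p. 43; §12.5 pp. 182–184] [cite: PlatonovRapinchuk1994, §6.4 Cor. 1] -/
theorem exists_cartanInputs (hns : ∀ w : PlacesOver L v, IsCMField.complexConj L • w.1 = w.1)
    [MeasurableSpace (Gqs L v)] [BorelSpace (Gqs L v)] [MeasurableSpace ((UnitaryGroup.cmDatum L 2 (Matrix.of fun i j : Fin 2 => if i.val + j.val + 1 = 2 then (1 : L) else 0)).Local v × (UnitaryGroup.cmDatum L 1 (Matrix.of fun i j : Fin 1 => if i.val + j.val + 1 = 1 then (1 : L) else 0)).Local v)] [BorelSpace ((UnitaryGroup.cmDatum L 2 (Matrix.of fun i j : Fin 2 => if i.val + j.val + 1 = 2 then (1 : L) else 0)).Local v × (UnitaryGroup.cmDatum L 1 (Matrix.of fun i j : Fin 1 => if i.val + j.val + 1 = 1 then (1 : L) else 0)).Local v)] :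
    ∃ (Sell : Finset (Subgroup (Gqs L v))) (μTf : (T' : Subgroup (Gqs L v)) → Measure ↥T') (SH : Finset (Subgroup ((UnitaryGroup.cmDatum L 2 (Matrix.of fun i j : Fin 2 => if i.val + j.val + 1 = 2 then (1 : L) else 0)).Local v × (UnitaryGroup.cmDatum L 1 (Matrix.of fun i j : Fin 1 => if i.val + j.val + 1 = 1 then (1 : L) else 0)).Local v))) (μTHf : (T' : Subgroup ((UnitaryGroup.cmDatum L 2 (Matrix.of fun i j : Fin 2 => if i.val + j.val + 1 = 2 then (1 : L) else 0)).Local v × (UnitaryGroup.cmDatum L 1 (Matrix.of fun i j : Fin 1 => if i.val + j.val + 1 = 1 then (1 : L) else 0)).Local v)) → Measure ↥T'),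
      -- hcartO
      (∀ T ∈ Sell, IsCompact (T : Set (Gqs L v)) ∧ ∃ γ₀ : Gqs L v, IsRegularElt (γ₀.val : GL (Fin 3) (UnitaryGroup.LocalRing L v)) ∧ T = Subgroup.centralizer ({γ₀} : Set (Gqs L v))) ∧
      -- hcovGO
      (∀ γ : (Gqs L v), IsRegularElt (γ.val : GL (Fin 3) (UnitaryGroup.LocalRing L v)) → ∃ T' ∈ insert (cmBorelTriple L 3 v).M Sell, ∃ x : (Gqs L v), ∀ g : (Gqs L v), g ∈ Subgroup.centralizer ({γ} : Set (Gqs L v)) ↔ x⁻¹ * g * x ∈ T') ∧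
      -- hncGO
      (∀ T' ∈ insert (cmBorelTriple L 3 v).M Sell, ∀ T'' ∈ insert (cmBorelTriple L 3 v).M Sell, T' ≠ T'' → ∀ y : (Gqs L v), ¬ ∀ h : (Gqs L v), h ∈ T'' ↔ y⁻¹ * h * y ∈ T') ∧
      -- hHaarGO
      (∀ T ∈ Sell, (μTf T).IsHaarMeasure) ∧
      -- hcoreGO
      (∀ T' ∈ Sell, μTf T' (compactCore ↥T') = 1) ∧
      -- hHaarMO
      (μTf (cmBorelTriple L 3 v).M).IsHaarMeasure ∧
      -- hcoreMO
      (μTf (cmBorelTriple L 3 v).M (compactCore ↥(cmBorelTriple L 3 v).M) = 1) ∧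
      -- hKHO
      (∀ T' ∈ SH, IsCompact (T' : Set ((UnitaryGroup.cmDatum L 2 (Matrix.of fun i j : Fin 2 => if i.val + j.val + 1 = 2 then (1 : L) else 0)).Local v × (UnitaryGroup.cmDatum L 1 (Matrix.of fun i j : Fin 1 => if i.val + j.val + 1 = 1 then (1 : L) else 0)).Local v)) ∧ ∃ γ₀ : ((UnitaryGroup.cmDatum L 2 (Matrix.of fun i j : Fin 2 => if i.val + j.val + 1 = 2 then (1 : L) else 0)).Local v × (UnitaryGroup.cmDatum L 1 (Matrix.of fun i j : Fin 1 => if i.val + j.val + 1 = 1 then (1 : L) else 0)).Local v), IsLocalGRegular L v γ₀ ∧ T' = Subgroup.centralizer ({γ₀} : Set ((UnitaryGroup.cmDatum L 2 (Matrix.of fun i j : Fin 2 => if i.val + j.val + 1 = 2 then (1 : L) else 0)).Local v × (UnitaryGroup.cmDatum L 1 (Matrix.of fun i j : Fin 1 => if i.val + j.val + 1 = 1 then (1 : L) else 0)).Local v))) ∧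
      -- hcovHO
      (∀ γ₀ : ((UnitaryGroup.cmDatum L 2 (Matrix.of fun i j : Fin 2 => if i.val + j.val + 1 = 2 then (1 : L) else 0)).Local v × (UnitaryGroup.cmDatum L 1 (Matrix.of fun i j : Fin 1 => if i.val + j.val + 1 = 1 then (1 : L) else 0)).Local v), IsLocalGRegular L v γ₀ → IsCompact ((Subgroup.centralizer ({γ₀} : Set ((UnitaryGroup.cmDatum L 2 (Matrix.of fun i j : Fin 2 => if i.val + j.val + 1 = 2 then (1 : L) else 0)).Local v × (UnitaryGroup.cmDatum L 1 (Matrix.of fun i j : Fin 1 => if i.val + j.val + 1 = 1 then (1 : L) else 0)).Local v)) : Subgroup ((UnitaryGroup.cmDatum L 2 (Matrix.of fun i j : Fin 2 => if i.val + j.val + 1 = 2 then (1 : L) else 0)).Local v × (UnitaryGroup.cmDatum L 1 (Matrix.of fun i j : Fin 1 => if i.val + j.val + 1 = 1 then (1 : L) else 0)).Local v)) : Set ((UnitaryGroup.cmDatum L 2 (Matrix.of fun i j : Fin 2 => if i.val + j.val + 1 = 2 then (1 : L) else 0)).Local v × (UnitaryGroup.cmDatum L 1 (Matrix.of fun i j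 : Fin 1 => if i.val + j.val + 1 = 1 then (1 : L) else 0)).Local v)) → ∃ T' ∈ SH, ∃ x : ((UnitaryGroup.cmDatum L 2 (Matrix.of fun i j : Fin 2 => if i.val + j.val + 1 = 2 then (1 : L) else 0)).Local v × (UnitaryGroup.cmDatum L 1 (Matrix.of fun i j : Fin 1 => if i.val + j.val + 1 = 1 then (1 : L) else 0)).Local v), Subgroup.centralizer ({x * γ₀ * x⁻¹} : Set ((UnitaryGroup.cmDatum L 2 (Matrix.of fun i j : Fin 2 => if i.val + j.val + 1 = 2 then (1 : L) else 0)).Local v × (UnitaryGroup.cmDatum L 1 (Matrix.of fun i j : Fin 1 => if i.val + j.val + 1 = 1 then (1 : L) else 0)).Local v)) = T') ∧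
      -- hncHO
      (∀ T' ∈ SH, ∀ T'' ∈ SH, (∃ x : ((UnitaryGroup.cmDatum L 2 (Matrix.of fun i j : Fin 2 => if i.val + j.val + 1 = 2 then (1 : L) else 0)).Local v × (UnitaryGroup.cmDatum L 1 (Matrix.of fun i j : Fin 1 => if i.val + j.val + 1 = 1 then (1 : L) else 0)).Local v), T'.map (MulAut.conj x).toMonoidHom = T'') → T' = T'') ∧
      -- hHaarHO
      (∀ T' ∈ SH, (μTHf T').IsHaarMeasure) ∧
      -- hprobHO
      (∀ T' ∈ SH, IsProbabilityMeasure (μTHf T')) := by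
  classical
  -- ★ CARTAN-ALL: the full system `C ∋ M` of Cartan representatives (regular-centraliser shape, non-`M` compact, complete, irredundant)
  obtain ⟨C, hM, hZ, hcpt, hcov, hirr⟩ := F0P3cStCharTSCartanAll.exists_cartanAll_weylShape L v hns
  -- ★ CARTAN-ELL-H: the `H_v` side with its Haar probability measures
  obtain ⟨SH, μTHf, h1, h2, h3⟩ := F0P3cStCharTSCartanFinTwo.cartanEllH L v hns
  -- ★ (E3): THE normalised Haar measure on each `T ∈ C` (mass one on the compact core), by choice
  have hex : ∀ T' ∈ C, ∃ tT : Measure ↥T', tT.IsHaarMeasure ∧ tT.IsInvInvariant ∧ tT (compactCore ↥T') = 1 := fun T' hT' => by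
    obtain ⟨γ₀, hγ₀, hT⟩ := hZ T' hT'
    exact F0P3cStCharTSWeylCartanOrbInt.exists_haar_cartan_compactCore_eq_one hγ₀ hT
  obtain ⟨μTf, hμTf⟩ : ∃ μTf : (T' : Subgroup (Gqs L v)) → Measure ↥T', ∀ T' ∈ C, (μTf T').IsHaarMeasure ∧ (μTf T').IsInvInvariant ∧ μTf T' (compactCore ↥T') = 1 :=
    ⟨fun T' => if h : T' ∈ C then (hex T' h).choose else 0, fun T' h => by simp only [dif_pos h]; exact (hex T' h).choose_spec⟩
  have hie : insert (cmBorelTriple L 3 v).M (C.erase (cmBorelTriple L 3 v).M) = C := Finset.insert_erase hM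
  refine ⟨C.erase (cmBorelTriple L 3 v).M, μTf, SH, μTHf, ?_, ?_, ?_, ?_, ?_, (hμTf _ hM).1, (hμTf _ hM).2.2, ?_, h2, h3, ?_, ?_⟩
  · intro T hT
    obtain ⟨hne, hTC⟩ := Finset.mem_erase.1 hT
    exact ⟨hcpt T hTC hne, hZ T hTC⟩
  · rw [hie]; exact hcov
  · rw [hie]; exact hirr
  · exact fun T' hT' => (hμTf T' (Finset.mem_erase.1 hT').2).1
  · exact fun T' hT' => (hμTf T' (Finset.mem_erase.1 hT').2).2.2
  · exact fun T' hT' => ⟨(h1 T' hT').1, (h1 T' hT').2.1⟩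
  · exact fun T' hT' => (h1 T' hT').2.2.1
  · exact fun T' hT' => (h1 T' hT').2.2.2

/-! ## ED. 2 — the same data WITH INVERSION-INVARIANCE of `μTf` exported (the `[∀ T, (tT T).IsInvInvariant]` instance binder of ★ (E4) WIF-AT-THE-DATUM) -/

open scoped Classical in
-- `insert M Sell` is read with the classical `DecidableEq (Subgroup G)`, as in ★ RUNG0 v4∕v5's binders
/-- **«INSTANTIATE-CARTAN» ED. 2** — as `exists_cartanInputs`, plus `hinvGO`∕`hinvMO`: the chosen `μTf T` (★ (E3)'s measure) is inversion invariant on each `T ∈ Sell` and on `M`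
(the extra instance the Weyl-integration consumer ★ `weylIntegrationFormula_of_cartanFinset_of_tubeJacobians` asks of `tT := 𝔇.μT`).
[cite: Rogawski1990, §3.6 pp. 28–31; §4.3 (4.3.1) p. 43; §12.5 pp. 182–184] [cite: PlatonovRapinchuk1994, §6.4 Cor. 1] -/
theorem exists_cartanInputs₂ (hns : ∀ w : PlacesOver L v, IsCMField.complexConj L • w.1 = w.1)
    [MeasurableSpace (Gqs L v)] [BorelSpace (Gqs L v)] [MeasurableSpace ((UnitaryGroup.cmDatum L 2 (Matrix.of fun i j : Fin 2 => if i.val + j.val + 1 = 2 then (1 : L) else 0)).Local v × (UnitaryGroup.cmDatum L 1 (Matrix.of fun i j : Fin 1 => if i.val + j.val + 1 = 1 then (1 : L) else 0)).Local v)] [BorelSpace ((UnitaryGroup.cmDatum L 2 (Matrix.of fun i j : Fin 2 => if i.val + j.val + 1 = 2 then (1 : L) else 0)).Local v × (UnitaryGroup.cmDatum L 1 (Matrix.of fun i j : Fin 1 => if i.val + j.val + 1 = 1 then (1 : L) else 0)).Local v)] :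
    ∃ (Sell : Finset (Subgroup (Gqs L v))) (μTf : (T' : Subgroup (Gqs L v)) → Measure ↥T') (SH : Finset (Subgroup ((UnitaryGroup.cmDatum L 2 (Matrix.of fun i j : Fin 2 => if i.val + j.val + 1 = 2 then (1 : L) else 0)).Local v × (UnitaryGroup.cmDatum L 1 (Matrix.of fun i j : Fin 1 => if i.val + j.val + 1 = 1 then (1 : L) else 0)).Local v))) (μTHf : (T' : Subgroup ((UnitaryGroup.cmDatum L 2 (Matrix.of fun i j : Fin 2 => if i.val + j.val + 1 = 2 then (1 : L) else 0)).Local v × (UnitaryGroup.cmDatum L 1 (Matrix.of fun i j : Fin 1 => if i.val + j.val + 1 = 1 then (1 : L) else 0)).Local v)) → Measure ↥T'),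
      -- hcartO
      (∀ T ∈ Sell, IsCompact (T : Set (Gqs L v)) ∧ ∃ γ₀ : Gqs L v, IsRegularElt (γ₀.val : GL (Fin 3) (UnitaryGroup.LocalRing L v)) ∧ T = Subgroup.centralizer ({γ₀} : Set (Gqs L v))) ∧
      -- hcovGO
      (∀ γ : (Gqs L v), IsRegularElt (γ.val : GL (Fin 3) (UnitaryGroup.LocalRing L v)) → ∃ T' ∈ insert (cmBorelTriple L 3 v).M Sell, ∃ x : (Gqs L v), ∀ g : (Gqs L v), g ∈ Subgroup.centralizer ({γ} : Set (Gqs L v)) ↔ x⁻¹ * g * x ∈ T') ∧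
      -- hncGO
      (∀ T' ∈ insert (cmBorelTriple L 3 v).M Sell, ∀ T'' ∈ insert (cmBorelTriple L 3 v).M Sell, T' ≠ T'' → ∀ y : (Gqs L v), ¬ ∀ h : (Gqs L v), h ∈ T'' ↔ y⁻¹ * h * y ∈ T') ∧
      -- hHaarGO
      (∀ T ∈ Sell, (μTf T).IsHaarMeasure) ∧
      -- hcoreGO
      (∀ T' ∈ Sell, μTf T' (compactCore ↥T') = 1) ∧
      -- hinvGO
      (∀ T' ∈ Sell, (μTf T').IsInvInvariant) ∧
      -- hHaarMO
      (μTf (cmBorelTriple L 3 v).M).IsHaarMeasure ∧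
      -- hcoreMO
      (μTf (cmBorelTriple L 3 v).M (compactCore ↥(cmBorelTriple L 3 v).M) = 1) ∧
      -- hinvMO
      (μTf (cmBorelTriple L 3 v).M).IsInvInvariant ∧
      -- hKHO
      (∀ T' ∈ SH, IsCompact (T' : Set ((UnitaryGroup.cmDatum L 2 (Matrix.of fun i j : Fin 2 => if i.val + j.val + 1 = 2 then (1 : L) else 0)).Local v × (UnitaryGroup.cmDatum L 1 (Matrix.of fun i j : Fin 1 => if i.val + j.val + 1 = 1 then (1 : L) else 0)).Local v)) ∧ ∃ γ₀ : ((UnitaryGroup.cmDatum L 2 (Matrix.of fun i j : Fin 2 => if i.val + j.val + 1 = 2 then (1 : L) else 0)).Local v × (UnitaryGroup.cmDatum L 1 (Matrix.of fun i j : Fin 1 => if i.val + j.val + 1 = 1 then (1 : L) else 0)).Local v), IsLocalGRegular L v γ₀ ∧ T' = Subgroup.centralizer ({γ₀} : Set ((UnitaryGroup.cmDatum L 2 (Matrix.of fun i j : Fin 2 => if i.val + j.val + 1 = 2 then (1 : L) else 0)).Local v × (UnitaryGroup.cmDatum L 1 (Matrix.of fun i j : Fin 1 => if i.val + j.val + 1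 = 1 then (1 : L) else 0)).Local v))) ∧
      -- hcovHO
      (∀ γ₀ : ((UnitaryGroup.cmDatum L 2 (Matrix.of fun i j : Fin 2 => if i.val + j.val + 1 = 2 then (1 : L) else 0)).Local v × (UnitaryGroup.cmDatum L 1 (Matrix.of fun i j : Fin 1 => if i.val + j.val + 1 = 1 then (1 : L) else 0)).Local v), IsLocalGRegular L v γ₀ → IsCompact ((Subgroup.centralizer ({γ₀} : Set ((UnitaryGroup.cmDatum L 2 (Matrix.of fun i j : Fin 2 => if i.val + j.val + 1 = 2 then (1 : L) else 0)).Local v × (UnitaryGroup.cmDatum L 1 (Matrix.of fun i j : Fin 1 => if i.val + j.val + 1 = 1 then (1 : L) else 0)).Local v)) : Subgroup ((UnitaryGroup.cmDatum L 2 (Matrix.of fun i j : Fin 2 => if i.val + j.val + 1 = 2 then (1 : L) else 0)).Local v × (UnitaryGroup.cmDatum L 1 (Matrix.of fun i j : Fin 1 => if i.val + j.val + 1 = 1 then (1 : L) else 0)).Local v)) : Set ((UnitaryGroup.cmDatum L 2 (Matrix.of fun i j : Fin 2 => if i.val + j.val + 1 = 2 then (1 : L) else 0)).Local v × (UnitaryGroup.cmDatum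 L 1 (Matrix.of fun i j : Fin 1 => if i.val + j.val + 1 = 1 then (1 : L) else 0)).Local v)) → ∃ T' ∈ SH, ∃ x : ((UnitaryGroup.cmDatum L 2 (Matrix.of fun i j : Fin 2 => if i.val + j.val + 1 = 2 then (1 : L) else 0)).Local v × (UnitaryGroup.cmDatum L 1 (Matrix.of fun i j : Fin 1 => if i.val + j.val + 1 = 1 then (1 : L) else 0)).Local v), Subgroup.centralizer ({x * γ₀ * x⁻¹} : Set ((UnitaryGroup.cmDatum L 2 (Matrix.of fun i j : Fin 2 => if i.val + j.val + 1 = 2 then (1 : L) else 0)).Local v × (UnitaryGroup.cmDatum L 1 (Matrix.of fun i j : Fin 1 => if i.val + j.val + 1 = 1 then (1 : L) else 0)).Local v)) = T') ∧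
      -- hncHO
      (∀ T' ∈ SH, ∀ T'' ∈ SH, (∃ x : ((UnitaryGroup.cmDatum L 2 (Matrix.of fun i j : Fin 2 => if i.val + j.val + 1 = 2 then (1 : L) else 0)).Local v × (UnitaryGroup.cmDatum L 1 (Matrix.of fun i j : Fin 1 => if i.val + j.val + 1 = 1 then (1 : L) else 0)).Local v), T'.map (MulAut.conj x).toMonoidHom = T'') → T' = T'') ∧
      -- hHaarHO
      (∀ T' ∈ SH, (μTHf T').IsHaarMeasure) ∧
      -- hprobHO
      (∀ T' ∈ SH, IsProbabilityMeasure (μTHf T')) := by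
  classical
  obtain ⟨C, hM, hZ, hcpt, hcov, hirr⟩ := F0P3cStCharTSCartanAll.exists_cartanAll_weylShape L v hns
  obtain ⟨SH, μTHf, h1, h2, h3⟩ := F0P3cStCharTSCartanFinTwo.cartanEllH L v hns
  have hex : ∀ T' ∈ C, ∃ tT : Measure ↥T', tT.IsHaarMeasure ∧ tT.IsInvInvariant ∧ tT (compactCore ↥T') = 1 := fun T' hT' => by
    obtain ⟨γ₀, hγ₀, hT⟩ := hZ T' hT'
    exact F0P3cStCharTSWeylCartanOrbInt.exists_haar_cartan_compactCore_eq_one hγ₀ hT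
  obtain ⟨μTf, hμTf⟩ : ∃ μTf : (T' : Subgroup (Gqs L v)) → Measure ↥T', ∀ T' ∈ C, (μTf T').IsHaarMeasure ∧ (μTf T').IsInvInvariant ∧ μTf T' (compactCore ↥T') = 1 :=
    ⟨fun T' => if h : T' ∈ C then (hex T' h).choose else 0, fun T' h => by simp only [dif_pos h]; exact (hex T' h).choose_spec⟩
  have hie : insert (cmBorelTriple L 3 v).M (C.erase (cmBorelTriple L 3 v).M) = C := Finset.insert_erase hM
  refine ⟨C.erase (cmBorelTriple L 3 v).M, μTf, SH, μTHf, ?_, ?_, ?_, ?_, ?_, ?_, (hμTf _ hM).1, (hμTf _ hM).2.2, (hμTf _ hM).2.1, ?_, h2, h3, ?_, ?_⟩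
  · intro T hT
    obtain ⟨hne, hTC⟩ := Finset.mem_erase.1 hT
    exact ⟨hcpt T hTC hne, hZ T hTC⟩
  · rw [hie]; exact hcov
  · rw [hie]; exact hirr
  · exact fun T' hT' => (hμTf T' (Finset.mem_erase.1 hT').2).1
  · exact fun T' hT' => (hμTf T' (Finset.mem_erase.1 hT').2).2.2
  · exact fun T' hT' => (hμTf T' (Finset.mem_erase.1 hT').2).2.1
  · exact fun T' hT' => ⟨(h1 T' hT').1, (h1 T' hT').2.1⟩
  · exact fun T' hT' => (h1 T' hT').2.2.1
  · exact fun T' hT' => (h1 T' hT').2.2.2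

end Summit.HodgeConjecture.HodgeConjecture.Cruxes.H413.F0P3cStCharTSRung0Cartan

end
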